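import Literature.RepresentationTheory.Kovacevic2021.SU21PrincipalSeriesReducibility
import HarnessLib

/-!
# The cohomological points of Kovačević's principal series: `V(0,0)`, `V(−3/2, 6)`, `V(−3/2, −6)`

Continuation of `…Kovacevic2021.SU21PrincipalSeriesReducibility` (Lie span of a `K`-type of `V(c,2t)` =
"no root of `a`/`b` crossed"; irreducibility iff no root).  On the cohomological parabola `6c + t² = 0`
(`SU21PrincipalSeriesData.principalSeries_parabola_of_finrank_relCohomology_ne_zero`) the three data
`V(0,0)` (`t = 0`), `V(−3/2, 6)` (`t = 3`), `V(−3/2, −6)` (`t = −3`) are REDUCIBLE, and the root lines of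
`a(p) = 2c−(p+1)t−p(p+2)`, `b(q) = 2c+(q+1)t−q(q+2)` cut their cones of `K`-types exactly into the `K`-type sets of
the six cohomological modules `J_{0,0}, J_{1,0}, J_{0,1}, D_0, D_1, D_2` of `SU21ModulesFromKTypes`
(`trivialMod`, `ladderPlus`, `ladderMinus`, `antiholDS`, `midDS`, `holDS`):

* `V(0,0)`: `a(p) = −p(p+2)`, `b(q) = −q(q+2)`, single roots `p = 0`, `q = 0`.  Submodule lattice (Lie spans of
  single `K`-types): the vertex `V_{1,0}` alone (`= J_{0,0}`) ⊂ the two strips `q = 0` (`J_{0,0} ⊔ J_{1,0}`-types)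
  and `p = 0` (`J_{0,0} ⊔ J_{0,1}`-types) ⊂ everything; every interior `K`-type (`p, q ≥ 1`, the `D_1`-types)
  generates `V(0,0)`.  [BorelWallach2000, VI 4.10 (10): the principal series at the infinitesimal character `ρ`
  has the constituents `J_{0,0}`, `J_{1,0}`, `J_{0,1}`, `D_1`; Kovačević §4: `V(c(0),0)` reducible, `U(0) = V_{10}`.]
* `V(−3/2, 6)`: `a(p) = −(p+2)(p+3)` never vanishes, `b(q) = q(1−q)`, roots `q = 0, 1`: the strip `q = 0`
  (`D_2`-types, `= U(0,6)`) ⊂ the strip `q ≤ 1` (`+ J_{1,0}`-types) ⊂ everything (`+ D_1`-types).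
* `V(−3/2, −6)`: symmetrically `a(p) = p(1−p)`, `b(q) = −(q+2)(q+3)`: `D_0` ⊂ `+ J_{0,1}` ⊂ `+ D_1`.

Only `K`-TYPE SUPPORTS are identified (as in `SU21ModulesFromKTypes`): an isomorphism of the subquotients
with the six data as `𝔤𝔩(3,ℂ)`-modules is NOT asserted here (the coefficients differ by a gauge).

## References

* D. Kovačević, *Unitary `(𝔤,K)` modules of `SU(2,1)`*, Acta Math. Spalatensia 1 (2021) 105–125
  (arXiv:1810.01752): §3 Thm 3, Remark 6; §4 (`c(0) = 0`, `U(0)`, `U(0,±6)`, `Z(±3)`, `W(3,0)`). [Kovacevic2021]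
* A. Borel, N. Wallach (2000), VI 4.8–4.10, (10) p. 131–132. [BorelWallach2000]
-/

noncomputable section

open Finsupp

namespace Literature.RepresentationTheory.Kovacevic2021

-- Mathlib idiom (Mathlib/Algebra/Lie/OfAssociative.lean): commutator brackets on associative algebras.
attribute [local instance 100] LieRing.ofAssociativeRing

namespace SU21Datum

open PrincipalSeries

/-! ## §1 `V(0,0)`: the principal series at the infinitesimal character `ρ` -/

/-- `a(p) = −p(p+2)` for `V(0,0)` [cite: Kovacevic2021, §3 (b85), §4 (`t = 0`)] -/
theorem acoef_zero_zero (p : ℤ) : acoef 0 0 p = ((-(p * (p + 2)) : ℤ) : ℂ) := by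
  simp only [acoef]; push_cast; ring

/-- `b(q) = −q(q+2)` for `V(0,0)` [cite: Kovacevic2021, §3 (b90), §4 (`t = 0`: "`−q²−2q+2c < 0`")] -/
theorem bcoef_zero_zero (q : ℤ) : bcoef 0 0 q = ((-(q * (q + 2)) : ℤ) : ℂ) := by
  simp only [bcoef]; push_cast; ring

/-- the only root of `a` on `V(0,0)` in `ℕ` is `p = 0` [cite: Kovacevic2021, §4 (`c(0) = 0`)] -/
theorem acoef_zero_zero_eq_zero_iff {p : ℤ} (hp : 0 ≤ p) : acoef 0 0 p = 0 ↔ p = 0 := by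
  rw [acoef_zero_zero, Int.cast_eq_zero, neg_eq_zero, mul_eq_zero]
  omega

/-- the only root of `b` on `V(0,0)` in `ℕ` is `q = 0` [cite: Kovacevic2021, §4 (`c(0) = 0`)] -/
theorem bcoef_zero_zero_eq_zero_iff {q : ℤ} (hq : 0 ≤ q) : bcoef 0 0 q = 0 ↔ q = 0 := by
  rw [bcoef_zero_zero, Int.cast_eq_zero, neg_eq_zero, mul_eq_zero]
  omega

/-- **`V(0,0)` is reducible** ("For `c = 0`, `V(c(0),0)` is reducible"). [cite: Kovacevic2021, §4 (`U(0)`)]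
[cite: BorelWallach2000, VI 4.10 (10)] -/
theorem principalSeries_zero_zero_not_isIrreducible :
    ¬ LieModule.IsIrreducible ℂ (Matrix (Fin 3) (Fin 3) ℂ) (principalSeries 0 0).V :=
  principalSeries_not_isIrreducible_of_acoef_eq_zero 0 0 le_rfl ((acoef_zero_zero_eq_zero_iff le_rfl).2 rfl)

/-- **The vertex `V_{1,0}` of `V(0,0)` spans a Lie submodule by itself** — the trivial module `U(0) = J_{0,0}`: the Lie
span of `u^1_{1,0}` contains no other `u^1_{(p,q)}`. [cite: Kovacevic2021, §4 ("`U(0) = V_{10}` is one-dimensional")]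
[cite: BorelWallach2000, VI 4.10 (10)] -/
theorem principalSeries_zero_zero_vec_mem_lieSpan_vertex_iff {p q : ℤ} (hp : 0 ≤ p) (hq : 0 ≤ q) :
    (principalSeries 0 0).vec (1 + p + q) (2 * 0 + 3 * p - 3 * q) 1 ∈
        LieSubmodule.lieSpan ℂ (Matrix (Fin 3) (Fin 3) ℂ) {(principalSeries 0 0).vec (1 + 0 + 0) (2 * 0 + 3 * 0 - 3 * 0) 1}
      ↔ p = 0 ∧ q = 0 := by
  rw [principalSeries_vec_mem_lieSpan_iff 0 0 le_rfl le_rfl hp hq]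
  constructor
  · rintro ⟨ha, hb⟩
    constructor
    · by_contra h
      exact ha 0 le_rfl (by omega) ((acoef_zero_zero_eq_zero_iff le_rfl).2 rfl)
    · by_contra h
      exact hb 0 le_rfl (by omega) ((bcoef_zero_zero_eq_zero_iff le_rfl).2 rfl)
  · rintro ⟨rfl, rfl⟩
    exact ⟨fun r hr hr' => by omega, fun s hs hs' => by omega⟩

/-- **The strip `q = 0` of `V(0,0)`** (`K`-types `V_{1+p,3p}`: `J_{0,0}` and the `J_{1,0}`-types): the Lie span of
any `u^1_{(p₀,0)}` with `p₀ ≥ 1` consists exactly of the `K`-types with `q = 0`.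
[cite: Kovacevic2021, §3 proof of Thm 3 ("a strip"), §4 (`Z(3)`)] [cite: BorelWallach2000, VI 4.10 (10)] -/
theorem principalSeries_zero_zero_vec_mem_lieSpan_iff_of_q_zero {p₀ p q : ℤ} (hp₀ : 1 ≤ p₀) (hp : 0 ≤ p)
    (hq : 0 ≤ q) :
    (principalSeries 0 0).vec (1 + p + q) (2 * 0 + 3 * p - 3 * q) 1 ∈
        LieSubmodule.lieSpan ℂ (Matrix (Fin 3) (Fin 3) ℂ)
          {(principalSeries 0 0).vec (1 + p₀ + 0) (2 * 0 + 3 * p₀ - 3 * 0) 1} ↔ q = 0 := by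
  rw [principalSeries_vec_mem_lieSpan_iff 0 0 (by omega) le_rfl hp hq]
  constructor
  · rintro ⟨-, hb⟩
    by_contra h
    exact hb 0 le_rfl (by omega) ((bcoef_zero_zero_eq_zero_iff le_rfl).2 rfl)
  · rintro rfl
    exact ⟨fun r hr _ h => by rw [acoef_zero_zero_eq_zero_iff (by omega)] at h; omega, fun s hs hs' => by omega⟩

/-- **The strip `p = 0` of `V(0,0)`** (`K`-types `V_{1+q,−3q}`: `J_{0,0}` and the `J_{0,1}`-types): the Lie span of
any `u^1_{(0,q₀)}` with `q₀ ≥ 1` consists exactly of the `K`-types with `p = 0`.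
[cite: Kovacevic2021, §3 proof of Thm 3 ("a strip"), §4 (`Z(−3)`)] [cite: BorelWallach2000, VI 4.10 (10)] -/
theorem principalSeries_zero_zero_vec_mem_lieSpan_iff_of_p_zero {q₀ p q : ℤ} (hq₀ : 1 ≤ q₀) (hp : 0 ≤ p)
    (hq : 0 ≤ q) :
    (principalSeries 0 0).vec (1 + p + q) (2 * 0 + 3 * p - 3 * q) 1 ∈
        LieSubmodule.lieSpan ℂ (Matrix (Fin 3) (Fin 3) ℂ)
          {(principalSeries 0 0).vec (1 + 0 + q₀) (2 * 0 + 3 * 0 - 3 * q₀) 1} ↔ p = 0 := by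
  rw [principalSeries_vec_mem_lieSpan_iff 0 0 le_rfl (by omega) hp hq]
  constructor
  · rintro ⟨ha, -⟩
    by_contra h
    exact ha 0 le_rfl (by omega) ((acoef_zero_zero_eq_zero_iff le_rfl).2 rfl)
  · rintro rfl
    exact ⟨fun r hr hr' => by omega, fun s hs _ h => by rw [bcoef_zero_zero_eq_zero_iff (by omega)] at h; omega⟩

/-- **Every interior `K`-type of `V(0,0)` (`p, q ≥ 1`: the `D_1`-types) generates the whole module**: `V(0,0)` has a
largest proper submodule (the union of the two strips), with quotient supported on the cone `W(3,0)` of `D_1`.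
[cite: Kovacevic2021, §3 proof of Thm 3, §4 (`W(3,0)`)] [cite: BorelWallach2000, VI 4.10 (10)] -/
theorem principalSeries_zero_zero_lieSpan_eq_top {p₀ q₀ : ℤ} (hp₀ : 1 ≤ p₀) (hq₀ : 1 ≤ q₀) :
    LieSubmodule.lieSpan ℂ (Matrix (Fin 3) (Fin 3) ℂ)
        {(principalSeries 0 0).vec (1 + p₀ + q₀) (2 * 0 + 3 * p₀ - 3 * q₀) 1} = ⊤ := by
  rw [eq_top_iff, (le_iff_forall_vec_one _ _)]
  intro n m hS _
  obtain ⟨p, q, hp, hq, rfl, rfl⟩ := (mem_principalSeries_S_iff 0 0 n m).1 hS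
  rw [principalSeries_vec_mem_lieSpan_iff 0 0 (by omega) (by omega) hp hq]
  exact ⟨fun r hr _ h => by rw [acoef_zero_zero_eq_zero_iff (by omega)] at h; omega,
    fun s hs _ h => by rw [bcoef_zero_zero_eq_zero_iff (by omega)] at h; omega⟩

/-- **The root lines cut the cone of `V(0,0)` into the `K`-type sets of `J_{0,0}`, `J_{1,0}`, `J_{0,1}`, `D_1`**:
the `K`-type `(1+p+q, 3p−3q)` is the `K`-type of `trivialMod` iff `p = q = 0`, a `K`-type of `ladderPlus` iff
`p ≥ 1, q = 0`, of `ladderMinus` iff `p = 0, q ≥ 1`, of `midDS` iff `p, q ≥ 1`.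
[cite: BorelWallach2000, VI 4.8, 4.10 (10)] [cite: Kovacevic2021, §4 (`U(0)`, `Z(±3)`, `W(3,0)`)] -/
theorem principalSeries_zero_zero_cells {p q : ℤ} (hp : 0 ≤ p) (hq : 0 ≤ q) :
    (((1 + p + q, 2 * 0 + 3 * p - 3 * q) : ℤ × ℤ) ∈ trivialMod.S ↔ p = 0 ∧ q = 0) ∧
    (((1 + p + q, 2 * 0 + 3 * p - 3 * q) : ℤ × ℤ) ∈ ladderPlus.S ↔ 1 ≤ p ∧ q = 0) ∧
    (((1 + p + q, 2 * 0 + 3 * p - 3 * q) : ℤ × ℤ) ∈ ladderMinus.S ↔ p = 0 ∧ 1 ≤ q) ∧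
    (((1 + p + q, 2 * 0 + 3 * p - 3 * q) : ℤ × ℤ) ∈ midDS.S ↔ 1 ≤ p ∧ 1 ≤ q) := by
  refine ⟨?_, ?_, ?_, ?_⟩
  · show _ ∈ ({((1 : ℤ), (0 : ℤ))} : Set (ℤ × ℤ)) ↔ _
    rw [Set.mem_singleton_iff, Prod.mk.injEq]
    omega
  · rw [mem_ladderPlus]; omega
  · rw [mem_ladderMinus]; omega
  · rw [mem_midDS]
    constructor
    · rintro ⟨p', q', h1, h2⟩; omega
    · rintro ⟨h1, h2⟩
      exact ⟨(p - 1).toNat, (q - 1).toNat, by omega, by omega⟩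

/-! ## §2 `V(−3/2, 6)`: the principal series containing the holomorphic discrete series `D_2` -/

/-- `a(p) = −(p²+5p+6) = −(p+2)(p+3)` for `V(−3/2,6)` [cite: Kovacevic2021, §3 (b85)] -/
theorem acoef_hol (p : ℤ) : acoef (-3 / 2) 3 p = ((-((p + 2) * (p + 3))) : ℤ) := by
  simp only [acoef]; push_cast; ring

/-- `b(q) = q(1−q)` for `V(−3/2,6)` [cite: Kovacevic2021, §3 (b90), §4 (`c(l,t)`)] -/
theorem bcoef_hol (q : ℤ) : bcoef (-3 / 2) 3 q = ((q * (1 - q)) : ℤ) := by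
  simp only [bcoef]; push_cast; ring

/-- `a` has no root in `ℕ` on `V(−3/2,6)` [cite: Kovacevic2021, §3 (b85)] -/
theorem acoef_hol_ne_zero {p : ℤ} (hp : 0 ≤ p) : acoef (-3 / 2) 3 p ≠ 0 := by
  rw [acoef_hol, Int.cast_ne_zero, neg_ne_zero]
  exact mul_ne_zero (by omega) (by omega)

/-- the roots of `b` on `V(−3/2,6)` in `ℕ` are `q = 0` and `q = 1` [cite: Kovacevic2021, §4 (`c(l,t)`)] -/
theorem bcoef_hol_eq_zero_iff {q : ℤ} (hq : 0 ≤ q) : bcoef (-3 / 2) 3 q = 0 ↔ q = 0 ∨ q = 1 := by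
  rw [bcoef_hol, Int.cast_eq_zero, mul_eq_zero]
  omega

/-- **`V(−3/2,6)` is reducible.** [cite: Kovacevic2021, §4 (`U(0,6)`)] [cite: BorelWallach2000, VI 4.10 (10)] -/
theorem principalSeries_hol_not_isIrreducible :
    ¬ LieModule.IsIrreducible ℂ (Matrix (Fin 3) (Fin 3) ℂ) (principalSeries (-3 / 2) 3).V :=
  principalSeries_not_isIrreducible_of_bcoef_eq_zero _ 3 le_rfl ((bcoef_hol_eq_zero_iff le_rfl).2 (Or.inl rfl))

/-- **The submodules of `V(−3/2,6)` generated by one `K`-type**: the Lie span of `u^1_{(p₀,q₀)}` contains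
`u^1_{(p,q)}` iff `q ≤ q₀` or `q₀ ≥ 2` — i.e. the strip `q = 0` (`D_2`-types, generated by any of its `K`-types),
the strip `q ≤ 1` (`+ J_{1,0}`-types), or everything (from any `K`-type with `q₀ ≥ 2`, the `D_1`-types).
[cite: Kovacevic2021, §3 proof of Thm 3, §4 (`U(0,6)`, `Z(3)`, `W(3,0)`)] [cite: BorelWallach2000, VI 4.10 (10)] -/
theorem principalSeries_hol_vec_mem_lieSpan_iff {p₀ q₀ p q : ℤ} (hp₀ : 0 ≤ p₀) (hq₀ : 0 ≤ q₀) (hp : 0 ≤ p)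
    (hq : 0 ≤ q) :
    (principalSeries (-3 / 2) 3).vec (1 + p + q) (2 * 3 + 3 * p - 3 * q) 1 ∈
        LieSubmodule.lieSpan ℂ (Matrix (Fin 3) (Fin 3) ℂ)
          {(principalSeries (-3 / 2) 3).vec (1 + p₀ + q₀) (2 * 3 + 3 * p₀ - 3 * q₀) 1} ↔ q ≤ q₀ ∨ 2 ≤ q₀ := by
  rw [principalSeries_vec_mem_lieSpan_iff _ 3 hp₀ hq₀ hp hq]
  constructor
  · rintro ⟨-, hb⟩
    by_contra h
    push Not at h
    rcases (show q₀ = 0 ∨ q₀ = 1 by omega) with rfl | rfl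
    · exact hb 0 le_rfl h.1 ((bcoef_hol_eq_zero_iff le_rfl).2 (Or.inl rfl))
    · exact hb 1 le_rfl h.1 ((bcoef_hol_eq_zero_iff zero_le_one).2 (Or.inr rfl))
  · intro h
    refine ⟨fun r hr _ => acoef_hol_ne_zero (by omega), fun s hs hsq hb => ?_⟩
    rw [bcoef_hol_eq_zero_iff (by omega)] at hb
    omega

/-- **The root lines cut the cone of `V(−3/2,6)` into the `K`-type sets of `D_2`, `J_{1,0}`, `D_1`**: the `K`-type
`(1+p+q, 6+3p−3q)` is a `K`-type of `holDS` iff `q = 0`, of `ladderPlus` iff `q = 1`, of `midDS` iff `q ≥ 2`.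
[cite: BorelWallach2000, VI 4.8, 4.10 (10)] [cite: Kovacevic2021, §4 (`U(0,6)`, `Z(3)`, `W(3,0)`)] -/
theorem principalSeries_hol_cells {p q : ℤ} (hp : 0 ≤ p) :
    (((1 + p + q, 2 * 3 + 3 * p - 3 * q) : ℤ × ℤ) ∈ holDS.S ↔ q = 0) ∧
    (((1 + p + q, 2 * 3 + 3 * p - 3 * q) : ℤ × ℤ) ∈ ladderPlus.S ↔ q = 1) ∧
    (((1 + p + q, 2 * 3 + 3 * p - 3 * q) : ℤ × ℤ) ∈ midDS.S ↔ 2 ≤ q) := by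
  refine ⟨?_, ?_, ?_⟩
  · rw [mem_holDS]; omega
  · rw [mem_ladderPlus]; omega
  · rw [mem_midDS]
    constructor
    · rintro ⟨p', q', h1, h2⟩; omega
    · intro h2
      exact ⟨p.toNat, (q - 2).toNat, by omega, by omega⟩

/-! ## §3 `V(−3/2, −6)`: the principal series containing the antiholomorphic discrete series `D_0` -/

/-- `a(p) = p(1−p)` for `V(−3/2,−6)` [cite: Kovacevic2021, §3 (b85), §4 (`t < 0`)] -/
theorem acoef_antihol (p : ℤ) : acoef (-3 / 2) (-3) p = ((p * (1 - p)) : ℤ) := by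
  simp only [acoef]; push_cast; ring

/-- `b(q) = −(q+2)(q+3)` for `V(−3/2,−6)` [cite: Kovacevic2021, §3 (b90)] -/
theorem bcoef_antihol (q : ℤ) : bcoef (-3 / 2) (-3) q = ((-((q + 2) * (q + 3))) : ℤ) := by
  simp only [bcoef]; push_cast; ring

/-- the roots of `a` on `V(−3/2,−6)` in `ℕ` are `p = 0` and `p = 1` [cite: Kovacevic2021, §4 (`c(l,t) = c(l,−t)`)] -/
theorem acoef_antihol_eq_zero_iff {p : ℤ} (hp : 0 ≤ p) : acoef (-3 / 2) (-3) p = 0 ↔ p = 0 ∨ p = 1 := by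
  rw [acoef_antihol, Int.cast_eq_zero, mul_eq_zero]
  omega

/-- `b` has no root in `ℕ` on `V(−3/2,−6)` [cite: Kovacevic2021, §3 (b90)] -/
theorem bcoef_antihol_ne_zero {q : ℤ} (hq : 0 ≤ q) : bcoef (-3 / 2) (-3) q ≠ 0 := by
  rw [bcoef_antihol, Int.cast_ne_zero, neg_ne_zero]
  exact mul_ne_zero (by omega) (by omega)

/-- **`V(−3/2,−6)` is reducible.** [cite: Kovacevic2021, §4 (`U(0,−6)`)] [cite: BorelWallach2000, VI 4.10 (10)] -/
theorem principalSeries_antihol_not_isIrreducible :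
    ¬ LieModule.IsIrreducible ℂ (Matrix (Fin 3) (Fin 3) ℂ) (principalSeries (-3 / 2) (-3)).V :=
  principalSeries_not_isIrreducible_of_acoef_eq_zero _ (-3) le_rfl
    ((acoef_antihol_eq_zero_iff le_rfl).2 (Or.inl rfl))

/-- **The submodules of `V(−3/2,−6)` generated by one `K`-type**: the Lie span of `u^1_{(p₀,q₀)}` contains
`u^1_{(p,q)}` iff `p ≤ p₀` or `p₀ ≥ 2` (strips `p = 0` = `D_0`-types, `p ≤ 1` = `+ J_{0,1}`-types, everything).
[cite: Kovacevic2021, §3 proof of Thm 3, §4 (`U(0,−6)`, `Z(−3)`, `W(3,0)`)] [cite: BorelWallach2000, VI 4.10 (10)] -/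
theorem principalSeries_antihol_vec_mem_lieSpan_iff {p₀ q₀ p q : ℤ} (hp₀ : 0 ≤ p₀) (hq₀ : 0 ≤ q₀) (hp : 0 ≤ p)
    (hq : 0 ≤ q) :
    (principalSeries (-3 / 2) (-3)).vec (1 + p + q) (2 * (-3) + 3 * p - 3 * q) 1 ∈
        LieSubmodule.lieSpan ℂ (Matrix (Fin 3) (Fin 3) ℂ)
          {(principalSeries (-3 / 2) (-3)).vec (1 + p₀ + q₀) (2 * (-3) + 3 * p₀ - 3 * q₀) 1} ↔
      p ≤ p₀ ∨ 2 ≤ p₀ := by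
  rw [principalSeries_vec_mem_lieSpan_iff _ (-3) hp₀ hq₀ hp hq]
  constructor
  · rintro ⟨ha, -⟩
    by_contra h
    push Not at h
    rcases (show p₀ = 0 ∨ p₀ = 1 by omega) with rfl | rfl
    · exact ha 0 le_rfl h.1 ((acoef_antihol_eq_zero_iff le_rfl).2 (Or.inl rfl))
    · exact ha 1 le_rfl h.1 ((acoef_antihol_eq_zero_iff zero_le_one).2 (Or.inr rfl))
  · intro h
    refine ⟨fun r hr hrp ha => ?_, fun s hs _ => bcoef_antihol_ne_zero (by omega)⟩
    rw [acoef_antihol_eq_zero_iff (by omega)] at ha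
    omega

/-- **The root lines cut the cone of `V(−3/2,−6)` into the `K`-type sets of `D_0`, `J_{0,1}`, `D_1`**: the
`K`-type `(1+p+q, −6+3p−3q)` is a `K`-type of `antiholDS` iff `p = 0`, of `ladderMinus` iff `p = 1`, of `midDS` iff
`p ≥ 2`. [cite: BorelWallach2000, VI 4.8, 4.10 (10)] [cite: Kovacevic2021, §4 (`U(0,−6)`, `Z(−3)`, `W(3,0)`)] -/
theorem principalSeries_antihol_cells {p q : ℤ} (hp : 0 ≤ p) (hq : 0 ≤ q) :
    (((1 + p + q, 2 * (-3) + 3 * p - 3 * q) : ℤ × ℤ) ∈ antiholDS.S ↔ p = 0) ∧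
    (((1 + p + q, 2 * (-3) + 3 * p - 3 * q) : ℤ × ℤ) ∈ ladderMinus.S ↔ p = 1) ∧
    (((1 + p + q, 2 * (-3) + 3 * p - 3 * q) : ℤ × ℤ) ∈ midDS.S ↔ 2 ≤ p) := by
  refine ⟨?_, ?_, ?_⟩
  · rw [mem_antiholDS]; omega
  · rw [mem_ladderMinus]; omega
  · rw [mem_midDS]
    constructor
    · rintro ⟨p', q', h1, h2⟩; omega
    · intro h2
      exact ⟨(p - 2).toNat, q.toNat, by omega, by omega⟩

/-- **The three cohomological principal-series data lie on the parabola `6c + t² = 0`** (consistency with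
`principalSeries_parabola_of_finrank_relCohomology_ne_zero`): `(c,t) = (0,0), (−3/2, 3), (−3/2, −3)`.
[cite: BorelWallach2000, II Cor. 3.3, VI 4.10] [cite: Kovacevic2021, §4] -/
theorem cohomologicalPoints_on_parabola :
    6 * (0 : ℂ) + ((0 : ℤ) : ℂ) ^ 2 = 0 ∧ 6 * (-3 / 2 : ℂ) + ((3 : ℤ) : ℂ) ^ 2 = 0 ∧
      6 * (-3 / 2 : ℂ) + ((-3 : ℤ) : ℂ) ^ 2 = 0 := by
  refine ⟨by norm_num, by norm_num, by norm_num⟩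

end SU21Datum

end Literature.RepresentationTheory.Kovacevic2021
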